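import Literature.Probability.LatticeModels.PlaneRotatorBoxBlockReduction
import Literature.Probability.LatticeModels.PlaneRotatorEnergyRenormalizedDecay
import HarnessLib

/-!
# The Ginibre path floor `⟨cos(θ_x − θ_y)⟩ ≥ u(K)^{|path|}` for ferromagnetic plane rotators, the two-sided
# window `u(K) ≤ E_L(K) ≤ 8K/(1+8K)` for the torus bond energy, and a statement-design lemma: no decay bound
# uniform in the volume can carry a divergent exponent

Topic `Literature/Probability/LatticeModels`. The LOWER ENVELOPE of the classical `η`-route (cell `pub/hubbard-tc`,
MO-S3, START-HERE §6 crux №2, classical side). Everything is Ginibre's second inequality for plane rotators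
(J. Ginibre, Comm. Math. Phys. **16** (1970) 310, Prop. 3 / Example 4: `⟨cos(m·θ)⟩` is non-decreasing in each
ferromagnetic coupling — tree `ginibreExpect_reChar_mono`, `twoPoint_le_of_embedding`) combined with the exact
two-spin value `⟨σ_a·σ_b⟩ = I₁(K)/I₀(K) =: u(K)` of E. H. Lieb, Comm. Math. Phys. **77** (1980) 127, eq. (25) (tree
`twoPoint_starCoupling_eq`, iterated along a chain by the exact leaf-transfer identity `twoPoint_add_leaf_transfer`):

* §1 `twoPoint_eq_of_symm` — pair couplings with the same symmetrisation `J(x,y) + J(y,x)` define the same Gibbs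
  state (`cos` is even); `symmCoupling`.
* §2 `twoPoint_chainSeg_eq_pow`, `twoPoint_chain_eq_pow` — **the chain EQUALITY** `⟨cos(θ_lo − θ_hi)⟩_{[lo,hi]} =
  u(K)^{hi−lo}` for the open chain of `PlaneRotatorChainTwoPoint.lean` (the tree had the upper bound
  `twoPoint_chain_le_pow` only).
* §3 `pow_besselRatio_le_twoPoint_of_path` — **the path floor**: on ANY finite vertex set with pair couplings
  `J ≥ 0`, along any injective path `x₀, …, xₙ` whose consecutive sites are coupled with `J(x_k,x_{k+1}) +
  J(x_{k+1},x_k) ≥ K ≥ 0`, `⟨cos(θ_{x₀} − θ_{xₙ})⟩_J ≥ u(K)^n` (switch off every bond off the path, then §2).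
* §4 `BondSystem.pairCoupling`, `BondSystem.expectJ_eq_ginibreExpect_pairCoupling`, `….expectJ_cosDiff_eq_twoPoint`
  — **bridge**: the bond-system Gibbs expectation `expectJ` of `PlaneRotatorJensenRotationBound.lean` (torus files)
  IS the pair-coupling Ginibre expectation of `PlaneRotatorGinibreComparison.lean` (box files) for the fibre-summed
  coupling `J(x,y) = ∑_{a : x → y} J_a`; `BondSystem.pow_besselRatio_le_expectJ_cosDiff_of_path`,
  `BondSystem.besselRatio_le_expectJ_reChar_bondChar` (every bond energy is at least its two-spin value).
* §5 torus `(ℤ/Lℤ)^d`: `torusXY_pow_besselRatio_le_expect_cosDiff` — `⟨cos(θ_x − θ_{x+n·eᵢ})⟩_{K,L} ≥ u(K)^n`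
  (`n < L`, uniformly in `L`); `besselRatio_le_torusXYBondEnergy` — **`E_L(K) ≥ u(K)`**; `torusXYBondEnergy_mono`
  (Ginibre monotonicity in `K`); **`torusXYBondEnergy_mem_Icc` — the kernel window `u(K) ≤ E_L(K) ≤ 8K/(1+8K)`**
  (`L ≥ 3`, `K > 0`; upper half = `torusXYBondEnergy_le` of `PlaneRotatorEnergyRenormalizedDecay.lean`);
  `energyExponent_le_inv` / `energyExponent_le_of_admissible` — every admissible energy ceiling `E` of the
  energy-renormalised McBryan–Spencer theorem satisfies `E ≥ u(K)`, so its exponent obeys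
  `2q − 2πK·E·q² ≤ 1/(2πK·u(K))`: a CEILING on what the energy class can ever certify.
* §6 `torusXY_not_uniform_decay_of_tendsto` — **statement design (crux №2)**: for `K > 0`, `B > 0`, any `A` and any
  exponent sequence `f_L → ∞`, the family of bounds `|⟨cos(θ_x − θ_y)⟩_{K,L}| ≤ A·B^{f_L}·(dist(x,y)+1)^{−f_L}`
  (the SHAPE of every decay theorem of the tree, there with `f` independent of `L`) CANNOT hold for all `L ≥ 3`
  (witness: `y = x + n·e₀`, `n + 1 > B`, where §5 gives `u(K)^n > 0` while the bound tends to `0`).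
  READING: a stiffness-class statement typed on a FINITE-VOLUME renormalised coupling `y_L(K)` («exponent
  `1/(2πK·y_L)`, constants uniform in `L`») is refutable at every `K` with `y_L(K) → 0` — for the finite-volume
  helicity modulus this is the whole high-temperature phase (`Υ_∞ = 0`; a located physics statement, not used in any
  proof here) — so such a conjecture must carry a window hypothesis (`y_L` bounded below, i.e. `T` below the putative
  transition) or the `L → ∞` stiffness; the ENERGY class is immune since `E_L(K) ≥ u(K) > 0` (§5).

HONEST FRAMING: classical plane rotators, finite volume; lower bounds by correlation inequalities and an arithmetic
no-go about the FORM of volume-uniform decay bounds; no statement about any quantum model, no number of record of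
the cell moves (WHAT-THIS-IS-NOT: not a bound on `T_KT`; the window's lower edge `u(K)` is the two-spin value, far
from the spin-wave energy `1 − 1/(4K)` [heuristic]).

References: J. Ginibre, Comm. Math. Phys. **16** (1970) 310–328, Prop. 3 / Example 4 [Ginibre1970]; E. H. Lieb,
Comm. Math. Phys. **77** (1980) 127–135, Theorem 4 and eq. (25) [Lieb1980]; O. A. McBryan, T. Spencer, Comm. Math.
Phys. **53** (1977) 299–302 [McBryanSpencer1977]; S. Friedli, Y. Velenik, *Statistical Mechanics of Lattice Systems*
(CUP 2017), §3.1, Thm 9.12 [FriedliVelenik2017].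
-/

noncomputable section

open MeasureTheory Filter Finset
open scoped BigOperators Topology

namespace Literature.Probability.LatticeModels

namespace PlaneRotator

/-! ### §1 Symmetrisation of pair couplings -/

section Symm

variable {V : Type*} [Fintype V]

omit [Fintype V] in
/-- `cos(θ_y − θ_x) = cos(θ_x − θ_y)`: the real parts of the pair characters of `(x, y)` and `(y, x)` agree.
[cite: Ginibre1970, Example 4 (plane rotators, cos(m·φ))] -/
theorem reChar_pairChars_swap (p : V × V) (θ : V → Circle) :
    reChar (pairChars V p.swap) θ = reChar (pairChars V p) θ := by
  rw [pairChars_apply, pairChars_apply, ← cosDiff_eq_reChar, ← cosDiff_eq_reChar, Prod.fst_swap, Prod.snd_swap]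
  unfold cosDiff
  rw [← Complex.conj_re (starRingEnd ℂ ((θ p.2 : Circle) : ℂ) * θ p.1), map_mul, Complex.conj_conj, mul_comm]

/-- `2·H_J(θ) = ∑_p (J(p) + J(p.swap)) cos_p(θ)`: the Hamiltonian only sees the symmetrised couplings.
[cite: Ginibre1970, Example 4 (plane rotators, cos(m·φ))] -/
theorem two_mul_ginibreHamiltonian_pairChars (J : V × V → ℝ) (θ : V → Circle) :
    2 * ginibreHamiltonian (pairChars V) J θ = ∑ p : V × V, (J p + J p.swap) * reChar (pairChars V p) θ := by
  unfold ginibreHamiltonian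
  have hswap : ∑ p : V × V, J p.swap * reChar (pairChars V p) θ = ∑ p : V × V, J p * reChar (pairChars V p) θ := by
    rw [← (Equiv.prodComm V V).sum_comp (fun p : V × V => J p.swap * reChar (pairChars V p) θ)]
    refine Finset.sum_congr rfl fun p _ => ?_
    simp only [Equiv.prodComm_apply, Prod.swap_swap]
    rw [reChar_pairChars_swap]
  simp only [add_mul, Finset.sum_add_distrib, hswap]
  ring

/-- **Pair couplings with the same symmetrisation define the same Hamiltonian.**
[cite: Ginibre1970, Example 4 (plane rotators, cos(m·φ))] -/
theorem ginibreHamiltonian_pairChars_eq_of_symm {J J' : V × V → ℝ}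
    (h : ∀ p : V × V, J p + J p.swap = J' p + J' p.swap) (θ : V → Circle) :
    ginibreHamiltonian (pairChars V) J θ = ginibreHamiltonian (pairChars V) J' θ := by
  have h2 := two_mul_ginibreHamiltonian_pairChars J θ
  have h2' := two_mul_ginibreHamiltonian_pairChars J' θ
  simp_rw [h] at h2
  linarith

variable [MeasurableSpace Circle] [BorelSpace Circle]

/-- **Pair couplings with the same symmetrisation have the same two-point functions** (indeed the same Gibbs
state). [cite: Ginibre1970, Example 4 (plane rotators, cos(m·φ))] -/
theorem twoPoint_eq_of_symm {J J' : V × V → ℝ} (h : ∀ p : V × V, J p + J p.swap = J' p + J' p.swap) (a b : V) :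
    twoPoint J a b = twoPoint J' a b := by
  unfold twoPoint ginibreExpect ginibreWeight
  simp_rw [ginibreHamiltonian_pairChars_eq_of_symm h]

/-- The symmetrised coupling `J^s(x,y) = (J(x,y) + J(y,x))/2`. [cite: Ginibre1970, Example 4 (plane rotators, cos(m·φ))] -/
def symmCoupling (J : V × V → ℝ) : V × V → ℝ := fun p => (J p + J p.swap) / 2

omit [Fintype V] [MeasurableSpace Circle] [BorelSpace Circle] in
/-- `J^s(p) + J^s(p.swap) = J(p) + J(p.swap)`. [cite: Ginibre1970, Example 4 (plane rotators, cos(m·φ))] -/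
theorem symmCoupling_add_swap (J : V × V → ℝ) (p : V × V) :
    symmCoupling J p + symmCoupling J p.swap = J p + J p.swap := by
  simp only [symmCoupling, Prod.swap_swap]
  ring

omit [Fintype V] [MeasurableSpace Circle] [BorelSpace Circle] in
/-- `J ≥ 0 ⇒ J^s ≥ 0`. [cite: Ginibre1970, Example 4 (plane rotators, cos(m·φ))] -/
theorem symmCoupling_nonneg {J : V × V → ℝ} (hJ : ∀ p, 0 ≤ J p) (p : V × V) : 0 ≤ symmCoupling J p := by
  unfold symmCoupling
  have := hJ p
  have := hJ p.swap
  positivity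

/-- `⟨cos(θ_a − θ_b)⟩_J = ⟨cos(θ_a − θ_b)⟩_{J^s}`. [cite: Ginibre1970, Example 4 (plane rotators, cos(m·φ))] -/
theorem twoPoint_symmCoupling (J : V × V → ℝ) (a b : V) : twoPoint (symmCoupling J) a b = twoPoint J a b :=
  twoPoint_eq_of_symm (symmCoupling_add_swap J) a b

end Symm

/-! ### §2 The open chain: `⟨cos(θ_lo − θ_hi)⟩_{[lo,hi]} = u(K)^{hi − lo}` exactly -/

section Chain

variable [MeasurableSpace Circle] [BorelSpace Circle] {n : ℕ} {K : ℝ}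

/-- `⟨cos(θ_a − θ_a)⟩ = 1`. [folklore] -/
private theorem twoPoint_self'' {V : Type*} [Fintype V] (J : V × V → ℝ) (a : V) : twoPoint J a a = 1 := by
  unfold twoPoint ginibreExpect
  have h1 : ∀ θ : V → Circle, cosDiff a a θ = 1 := fun θ => by
    rw [cosDiff, ← Complex.normSq_eq_conj_mul_self, Complex.ofReal_re, Circle.normSq_coe]
  simp_rw [h1, one_mul]
  exact div_self (integral_exp_pos (integrable_torusHaar_of_continuous (continuous_ginibreWeight _ _))).ne'

/-- **The chain equality**: in the segment `[lo, hi]` of the open XY chain (coupling `K`, free ends),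
`⟨cos(θ_lo − θ_hi)⟩ = u(K)^{hi − lo}`, `u = I₁/I₀` — strip the left end `hi − lo` times with the exact
leaf-transfer identity `twoPoint_add_leaf_transfer'` (each dangling end contributes the two-spin value `u(K)`;
Fisher's classical chain). [cite: Lieb1980, Theorem 4 and eq. (25) (two-spin system, I₁(β)/I₀(β))] -/
theorem twoPoint_chainSeg_eq_pow {lo hi : ℕ} (hlo : lo ≤ hi) (hhi : hi ≤ n) :
    twoPoint (chainSegCoupling n K lo hi) ⟨lo, by omega⟩ ⟨hi, by omega⟩ = besselRatio K ^ (hi - lo) := by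
  classical
  -- induction on the number `k = hi - lo` of bonds, the right end `hi` fixed
  have key : ∀ (k lo : ℕ) (h : lo + k = hi),
      twoPoint (chainSegCoupling n K lo hi) ⟨lo, by omega⟩ ⟨hi, by omega⟩ = besselRatio K ^ k := by
    intro k
    induction k with
    | zero =>
      intro lo h
      have : (⟨lo, by omega⟩ : Fin (n + 1)) = ⟨hi, by omega⟩ := Fin.ext (by simp; omega)
      rw [this, twoPoint_self'', pow_zero]
    | succ k ih =>
      intro lo h
      have hlo1 : lo + 1 ≤ hi := by omega
      have hf : lo + 1 < n + 1 := by omega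
      set f : Fin (n + 1) := ⟨lo + 1, hf⟩ with hfdef
      set Lset : Finset (Fin (n + 1)) := Finset.univ.filter fun i => lo + 1 ≤ (i : ℕ) with hL
      have hmemL : ∀ i : Fin (n + 1), i ∈ Lset ↔ lo + 1 ≤ (i : ℕ) := fun i => by simp [hL]
      have hv : (⟨lo, by omega⟩ : Fin (n + 1)) ∉ Lset := fun h => by have := (hmemL _).1 h; simp at this
      have ha : (⟨hi, by omega⟩ : Fin (n + 1)) ∈ Lset := (hmemL _).2 (by simp; omega)
      rw [chainSegCoupling_eq_add_endBond hlo1]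
      rw [twoPoint_add_leaf_transfer' (L := Lset) (foot := fun _ => f) (fun v _ => (hmemL f).2 (by simp [hfdef]))
        (fun p hp => ?_) (fun p hp => ?_) ha hv]
      · -- the dangling coupling at the left end is `K/2 + K/2 = K`, and the rest is the segment `[lo+1, hi]`
        have hD : (if (((f : Fin (n + 1)) : ℕ) = lo ∧ ((⟨lo, by omega⟩ : Fin (n + 1)) : ℕ) = lo + 1) ∨
              (((⟨lo, by omega⟩ : Fin (n + 1)) : ℕ) = lo ∧ ((f : Fin (n + 1)) : ℕ) = lo + 1) then K / 2 else 0) +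
            (if ((((⟨lo, by omega⟩ : Fin (n + 1)) : ℕ) = lo ∧ ((f : Fin (n + 1)) : ℕ) = lo + 1) ∨
              (((f : Fin (n + 1)) : ℕ) = lo ∧ ((⟨lo, by omega⟩ : Fin (n + 1)) : ℕ) = lo + 1)) then K / 2 else 0) = K := by
          simp [hfdef]
        simp only at hD ⊢
        rw [hD, ih (lo + 1) (by omega), pow_succ, mul_comm]
      · rcases chainSegCoupling_ne_zero hp with ⟨h1, h2, -⟩ | ⟨h1, h2, -⟩
        · exact ⟨(hmemL _).2 h1, (hmemL _).2 (by omega)⟩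
        · exact ⟨(hmemL _).2 (by omega), (hmemL _).2 h1⟩
      · have hp' : ((p.1 : ℕ) = lo ∧ (p.2 : ℕ) = lo + 1) ∨ ((p.2 : ℕ) = lo ∧ (p.1 : ℕ) = lo + 1) := by
          by_contra hc; exact hp (if_neg hc)
        rcases hp' with ⟨h1, h2⟩ | ⟨h1, h2⟩
        · left
          exact ⟨fun hm => by have := (hmemL _).1 hm; omega, Fin.ext (by simp [hfdef, h2])⟩
        · right
          exact ⟨fun hm => by have := (hmemL _).1 hm; omega, Fin.ext (by simp [hfdef, h2])⟩
  have := key (hi - lo) lo (by omega)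
  exact this

/-- **The full chain**: `⟨cos(θ_0 − θ_n)⟩_{chain of n bonds} = u(K)^n`. [cite: Lieb1980, Theorem 4 and eq. (25)] -/
theorem twoPoint_chain_eq_pow (n : ℕ) (K : ℝ) :
    twoPoint (chainCoupling n K) 0 (Fin.last n) = besselRatio K ^ n := by
  have h := twoPoint_chainSeg_eq_pow (n := n) (K := K) (lo := 0) (hi := n) (Nat.zero_le n) le_rfl
  simp only [Nat.sub_zero] at h
  exact h

end Chain

/-! ### §3 The path floor on any finite ferromagnetic rotator system -/

section Path

variable {V : Type*} [Fintype V] [MeasurableSpace Circle] [BorelSpace Circle]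

omit [Fintype V] [MeasurableSpace Circle] [BorelSpace Circle] in
/-- A non-zero chain coupling is `K/2` on a nearest-neighbour pair. [cite: Lieb1980, eqs. (4)–(5)] -/
private theorem chainCoupling_eq_half_of_ne_zero {n : ℕ} {K : ℝ} {p : Fin (n + 1) × Fin (n + 1)}
    (hp : chainCoupling n K p ≠ 0) :
    chainCoupling n K p = K / 2 ∧ (((p.1 : ℕ) + 1 = p.2) ∨ ((p.2 : ℕ) + 1 = p.1)) := by
  unfold chainCoupling chainSegCoupling at hp ⊢
  split_ifs at hp ⊢ with h
  · exact ⟨rfl, h.elim (fun h => Or.inl h.2.1) (fun h => Or.inr h.2.1)⟩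
  · exact absurd rfl hp

/-- **The Ginibre path floor.** On a finite vertex set `V` with pair couplings `J ≥ 0`, let `x₀, …, xₙ` be an
injective path whose consecutive sites are coupled with total strength `J(x_k, x_{k+1}) + J(x_{k+1}, x_k) ≥ K ≥ 0`.
Then `⟨cos(θ_{x₀} − θ_{xₙ})⟩_{V,J} ≥ u(K)^n`, `u = I₁/I₀`: by Ginibre's comparison (`twoPoint_le_of_embedding`)
the two-point function dominates that of the bare chain of `n` bonds of strength `K` (all other couplings switched
off, all other rotators free), which is `u(K)^n` exactly (`twoPoint_chain_eq_pow`).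
[cite: Ginibre1970, Prop. 3 with Example 4 (plane rotators)] -/
theorem pow_besselRatio_le_twoPoint_of_path {J : V × V → ℝ} (hJ : ∀ p, 0 ≤ J p) {n : ℕ} {τ : Fin (n + 1) → V}
    (hτ : Function.Injective τ) {K : ℝ} (hK : 0 ≤ K)
    (hpath : ∀ k : Fin n, K ≤ J (τ k.castSucc, τ k.succ) + J (τ k.succ, τ k.castSucc)) :
    besselRatio K ^ n ≤ twoPoint J (τ 0) (τ (Fin.last n)) := by
  rw [← twoPoint_symmCoupling J, ← twoPoint_chain_eq_pow n K]
  refine twoPoint_le_of_embedding hτ (chainCoupling_nonneg hK) (symmCoupling_nonneg hJ) (fun x y => ?_) 0 (Fin.last n)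
  by_cases h0 : chainCoupling n K (x, y) = 0
  · rw [h0]; exact symmCoupling_nonneg hJ _
  obtain ⟨hval, hnn⟩ := chainCoupling_eq_half_of_ne_zero h0
  rw [hval]
  simp only [symmCoupling, Prod.swap_prod_mk]
  rcases hnn with h | h
  · have hx : (x : ℕ) < n := by have := y.isLt; simp at h; omega
    have hk := hpath ⟨x, hx⟩
    have h1 : (⟨(x : ℕ), hx⟩ : Fin n).castSucc = x := Fin.ext rfl
    have h2 : (⟨(x : ℕ), hx⟩ : Fin n).succ = y := Fin.ext (by simp; simpa using h)
    rw [h1, h2] at hk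
    linarith
  · have hy : (y : ℕ) < n := by have := x.isLt; simp at h; omega
    have hk := hpath ⟨y, hy⟩
    have h1 : (⟨(y : ℕ), hy⟩ : Fin n).castSucc = y := Fin.ext rfl
    have h2 : (⟨(y : ℕ), hy⟩ : Fin n).succ = x := Fin.ext (by simp; simpa using h)
    rw [h1, h2] at hk
    linarith

end Path

end PlaneRotator

/-! ### §4 Bond systems: `expectJ` is a pair-coupling Ginibre expectation -/

namespace BondSystem

section Bridge

variable {V ι : Type*} [Fintype V] [Fintype ι] [DecidableEq V] (G : BondSystem V ι)

/-- The **fibre-summed pair coupling** of bond couplings `J : ι → ℝ`: `J(x, y) = ∑_{a : src a = x, tgt a = y} J_a`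
(ordered pairs; for a bond system without parallel bonds this is `J_a` on `(src a, tgt a)` and `0` elsewhere).
[cite: Ginibre1970, Example 4 (plane rotators, general couplings J_A)] -/
def pairCoupling (J : ι → ℝ) : V × V → ℝ :=
  fun p => ∑ a ∈ Finset.univ.filter (fun a => (G.src a, G.tgt a) = p), J a

omit [Fintype V] in
/-- `J ≥ 0 ⇒` the pair coupling is `≥ 0`. [cite: Ginibre1970, Example 4 (plane rotators, general couplings J_A)] -/
theorem pairCoupling_nonneg {J : ι → ℝ} (hJ : ∀ a, 0 ≤ J a) (p : V × V) : 0 ≤ G.pairCoupling J p :=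
  Finset.sum_nonneg fun a _ => hJ a

omit [Fintype V] in
/-- For `J ≥ 0` every bond contributes to the pair coupling of its endpoints: `J_a ≤ J(src a, tgt a)`.
[cite: Ginibre1970, Example 4 (plane rotators, general couplings J_A)] -/
theorem le_pairCoupling {J : ι → ℝ} (hJ : ∀ a, 0 ≤ J a) (a : ι) : J a ≤ G.pairCoupling J (G.src a, G.tgt a) :=
  Finset.single_le_sum (f := J) (fun b _ => hJ b) (Finset.mem_filter.2 ⟨Finset.mem_univ a, rfl⟩)

/-- **The bond Hamiltonian is the pair Hamiltonian of the fibre-summed coupling**: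
`∑_a J_a cos(θ_{tgt a} − θ_{src a}) = ∑_{(x,y)} J(x,y) cos(θ_y − θ_x)`. [cite: Ginibre1970, Example 4 (plane rotators, general couplings J_A)] -/
theorem ginibreHamiltonian_bondChar_eq_pairCoupling (J : ι → ℝ) (θ : V → Circle) :
    ginibreHamiltonian G.bondChar J θ = ginibreHamiltonian (PlaneRotator.pairChars V) (G.pairCoupling J) θ := by
  unfold ginibreHamiltonian pairCoupling
  rw [← Finset.sum_fiberwise Finset.univ (fun a => (G.src a, G.tgt a)) (fun a => J a * reChar (G.bondChar a) θ)]
  refine Finset.sum_congr rfl fun p _ => ?_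
  rw [Finset.sum_mul]
  refine Finset.sum_congr rfl fun a ha => ?_
  rw [← (Finset.mem_filter.1 ha).2]
  rfl

variable [MeasurableSpace Circle] [BorelSpace Circle]

/-- **Bridge**: the bond-system Gibbs expectation `⟨f⟩_J` (`expectJ`, vocabulary of the torus decay files) is the
pair-coupling Ginibre expectation (vocabulary of `PlaneRotatorGinibreComparison.lean`) of the fibre-summed coupling.
[cite: Ginibre1970, Example 4 (plane rotators, general couplings J_A)] -/
theorem expectJ_eq_ginibreExpect_pairCoupling (J : ι → ℝ) (f : (V → Circle) → ℝ) :
    G.expectJ J f = ginibreExpect (torusHaar V) (PlaneRotator.pairChars V) (G.pairCoupling J) f := by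
  unfold expectJ ginibreExpect ginibreWeight
  simp_rw [G.ginibreHamiltonian_bondChar_eq_pairCoupling J]

/-- **Bridge for two-point functions**: `⟨cos(θ_x − θ_y)⟩_J = twoPoint (pairCoupling J) x y`.
[cite: Ginibre1970, Example 4 (plane rotators, general couplings J_A)] -/
theorem expectJ_cosDiff_eq_twoPoint (J : ι → ℝ) (x y : V) :
    G.expectJ J (cosDiff x y) = PlaneRotator.twoPoint (G.pairCoupling J) x y := by
  rw [PlaneRotator.twoPoint, expectJ_eq_ginibreExpect_pairCoupling]

/-- **Bridge for bond energies**: `⟨cos(∇θ)_a⟩_J = twoPoint (pairCoupling J) (src a) (tgt a)`.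
[cite: Ginibre1970, Example 4 (plane rotators, general couplings J_A)] -/
theorem expectJ_reChar_bondChar_eq_twoPoint (J : ι → ℝ) (a : ι) :
    G.expectJ J (reChar (G.bondChar a)) = PlaneRotator.twoPoint (G.pairCoupling J) (G.src a) (G.tgt a) := by
  rw [← expectJ_cosDiff_eq_twoPoint]
  congr 1
  funext θ
  exact (cosDiff_eq_reChar (G.src a) (G.tgt a) θ).symm

/-- **The path floor for bond systems**: `J ≥ 0`, an injective path `x₀, …, xₙ` in `V` each of whose steps
`{x_k, x_{k+1}}` is a bond (either orientation) of coupling `≥ K ≥ 0` ⇒ `⟨cos(θ_{x₀} − θ_{xₙ})⟩_J ≥ u(K)^n`.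
[cite: Ginibre1970, Prop. 3 with Example 4 (plane rotators)] -/
theorem pow_besselRatio_le_expectJ_cosDiff_of_path {J : ι → ℝ} (hJ : ∀ a, 0 ≤ J a) {n : ℕ}
    {τ : Fin (n + 1) → V} (hτ : Function.Injective τ) {K : ℝ} (hK : 0 ≤ K)
    (hpath : ∀ k : Fin n, ∃ a, K ≤ J a ∧
      ((G.src a = τ k.castSucc ∧ G.tgt a = τ k.succ) ∨ (G.src a = τ k.succ ∧ G.tgt a = τ k.castSucc))) :
    PlaneRotator.besselRatio K ^ n ≤ G.expectJ J (cosDiff (τ 0) (τ (Fin.last n))) := by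
  rw [expectJ_cosDiff_eq_twoPoint]
  refine PlaneRotator.pow_besselRatio_le_twoPoint_of_path (G.pairCoupling_nonneg hJ) hτ hK fun k => ?_
  obtain ⟨a, hKa, h⟩ := hpath k
  rcases h with ⟨hs, ht⟩ | ⟨hs, ht⟩
  · have h1 := G.le_pairCoupling hJ a
    rw [hs, ht] at h1
    have h2 := G.pairCoupling_nonneg hJ (τ k.succ, τ k.castSucc)
    linarith
  · have h1 := G.le_pairCoupling hJ a
    rw [hs, ht] at h1
    have h2 := G.pairCoupling_nonneg hJ (τ k.castSucc, τ k.succ)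
    linarith

/-- **Every bond energy is at least its two-spin value**: for `J ≥ 0` and a bond `a` with distinct endpoints,
`⟨cos(∇θ)_a⟩_J ≥ u(J_a) = I₁(J_a)/I₀(J_a)` (the bond alone, all others switched off — Lieb's "two-spin system").
[cite: Lieb1980, Theorem 4 and eq. (25) (two-spin system, I₁(β)/I₀(β))] -/
theorem besselRatio_le_expectJ_reChar_bondChar {J : ι → ℝ} (hJ : ∀ a, 0 ≤ J a) (a : ι) (hne : G.src a ≠ G.tgt a) :
    PlaneRotator.besselRatio (J a) ≤ G.expectJ J (reChar (G.bondChar a)) := by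
  have hcos : reChar (G.bondChar a) = cosDiff (G.src a) (G.tgt a) :=
    funext fun θ => (cosDiff_eq_reChar (G.src a) (G.tgt a) θ).symm
  rw [hcos]
  set τ : Fin 2 → V := ![G.src a, G.tgt a] with hτdef
  have hτ : Function.Injective τ := by
    intro i j h
    fin_cases i <;> fin_cases j
    · rfl
    · exact absurd h (by simpa [hτdef] using hne)
    · exact absurd h (by simpa [hτdef] using hne.symm)
    · rfl
  have h := G.pow_besselRatio_le_expectJ_cosDiff_of_path hJ (n := 1) hτ (hJ a) fun k => ⟨a, le_rfl, Or.inl (by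
    fin_cases k; exact ⟨rfl, rfl⟩)⟩
  simpa [hτdef] using h

end Bridge

end BondSystem

/-! ### §5 The torus `(ℤ/Lℤ)^d`: path floor, energy floor, the window, the exponent ceiling -/

section Torus

open PlaneRotator Literature.MathematicalPhysics.QuantumLattice

variable {d L : ℕ} [NeZero L]

omit [NeZero L] in
/-- The straight lattice path `k ↦ x + k·eᵢ`, `k ≤ n`, is injective on the torus as soon as `n < L`.
[cite: FriedliVelenik2017, §3.1 (periodic boundary condition)] -/
theorem straightPath_injective {n : ℕ} (hn : n < L) (x : TorusSite d L) (i : Fin d) :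
    Function.Injective fun k : Fin (n + 1) => x + Pi.single i (((k : ℕ) : ZMod L)) := by
  intro k k' h
  have h1 := congrFun h i
  simp only [Pi.add_apply, Pi.single_eq_same, add_right_inj] at h1
  have h2 := congrArg ZMod.val h1
  rw [ZMod.val_natCast_of_lt (by omega), ZMod.val_natCast_of_lt (by omega)] at h2
  exact Fin.ext h2

omit [NeZero L] in
/-- One step of the straight path is the torus bond `(x + k·eᵢ, i)`.
[cite: FriedliVelenik2017, §3.1 (periodic boundary condition)] -/
theorem straightPath_succ (x : TorusSite d L) (i : Fin d) (k : ℕ) :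
    x + Pi.single i (((k + 1 : ℕ) : ZMod L)) = (x + Pi.single i ((k : ℕ) : ZMod L)) + Pi.single i 1 := by
  rw [add_assoc, ← Pi.single_add, Nat.cast_succ]

variable [MeasurableSpace Circle] [BorelSpace Circle]

/-- **The torus path floor**: for `K ≥ 0`, `n < L`, every site `x` and direction `i` of `(ℤ/Lℤ)^d`,
`⟨cos(θ_x − θ_{x + n·eᵢ})⟩_{K,L} ≥ u(K)^n`, uniformly in `L` (general-coupling form `expectJ`).
[cite: Ginibre1970, Prop. 3 with Example 4 (plane rotators)] -/
theorem torusXY_pow_besselRatio_le_expectJ_cosDiff {n : ℕ} (hn : n < L) {K : ℝ} (hK : 0 ≤ K)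
    (x : TorusSite d L) (i : Fin d) :
    besselRatio K ^ n ≤
      (torusXY d L).expectJ (fun _ => K) (cosDiff x (x + Pi.single i ((n : ℕ) : ZMod L))) := by
  classical
  have h := (torusXY d L).pow_besselRatio_le_expectJ_cosDiff_of_path (J := fun _ => K) (fun _ => hK)
    (straightPath_injective hn x i) hK (fun k => ⟨(x + Pi.single i ((((k.castSucc : Fin (n + 1)) : ℕ) : ZMod L)), i),
      le_rfl, Or.inl ⟨rfl, ?_⟩⟩)
  · simpa using h
  · show (x + Pi.single i ((((k.castSucc : Fin (n + 1)) : ℕ) : ZMod L))) + Pi.single i 1 =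
      x + Pi.single i ((((k.succ : Fin (n + 1)) : ℕ) : ZMod L))
    rw [Fin.val_succ, Fin.val_castSucc, straightPath_succ]

/-- The torus path floor in the `expect K 1` form of the decay theorems
(`torusXY_abs_expect_cosDiff_le_rpow` and its energy-renormalised versions). [cite: Ginibre1970, Prop. 3 with Example 4 (plane rotators)] -/
theorem torusXY_pow_besselRatio_le_expect_cosDiff {n : ℕ} (hn : n < L) {K : ℝ} (hK : 0 ≤ K)
    (x : TorusSite d L) (i : Fin d) :
    besselRatio K ^ n ≤ (torusXY d L).expect K 1 (cosDiff x (x + Pi.single i ((n : ℕ) : ZMod L))) := by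
  rw [(torusXY d L).expect_one_eq_expectJ]
  exact torusXY_pow_besselRatio_le_expectJ_cosDiff hn hK x i

/-- **The energy floor `E_L(K) ≥ u(K)`**: every nearest-neighbour bond energy of the two-dimensional torus at
uniform coupling `K ≥ 0` is at least the two-spin value `I₁(K)/I₀(K)` (`L ≥ 2`, so that bonds have distinct
endpoints). [cite: Lieb1980, Theorem 4 and eq. (25) (two-spin system, I₁(β)/I₀(β))] -/
theorem besselRatio_le_torusXYBondEnergy (hL : 2 ≤ L) {K : ℝ} (hK : 0 ≤ K) (b : TorusSite 2 L × Fin 2) :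
    besselRatio K ≤ torusXYBondEnergy L K b := by
  classical
  haveI : Fact (1 < L) := ⟨by omega⟩
  have hne : (torusXY 2 L).src b ≠ (torusXY 2 L).tgt b := by
    show b.1 ≠ b.1 + Pi.single b.2 1
    intro h
    have h1 := congrFun h b.2
    simp only [Pi.add_apply, Pi.single_eq_same, left_eq_add] at h1
    exact one_ne_zero h1
  exact (torusXY 2 L).besselRatio_le_expectJ_reChar_bondChar (J := fun _ => K) (fun _ => hK) b hne

/-- **Ginibre monotonicity of the torus bond energy in the coupling**: `0 ≤ K ≤ K' ⇒ E_L(K) ≤ E_L(K')`.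
[cite: Ginibre1970, Prop. 3 with Example 4 (plane rotators)] -/
theorem torusXYBondEnergy_mono {K K' : ℝ} (hK : 0 ≤ K) (hKK' : K ≤ K') (b : TorusSite 2 L × Fin 2) :
    torusXYBondEnergy L K b ≤ torusXYBondEnergy L K' b :=
  (torusXY 2 L).expectJ_reChar_mono (J := fun _ => K) (J' := fun _ => K') (fun _ => hK) (fun _ => hKK') _

/-- **The kernel window for the torus bond energy**: for `L ≥ 3` and `K > 0`,
`u(K) ≤ E_L(K) ≤ 8K/(1 + 8K)` — two-spin floor (Ginibre) and local-Ward ceiling (`torusXYBondEnergy_le`).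
[cite: Lieb1980, Theorem 4 and eq. (25); AizenmanSimon1980LocalWard, eq. (2.4)] -/
theorem torusXYBondEnergy_mem_Icc (hL : 3 ≤ L) {K : ℝ} (hK : 0 < K) (b : TorusSite 2 L × Fin 2) :
    torusXYBondEnergy L K b ∈ Set.Icc (besselRatio K) (8 * K / (1 + 8 * K)) :=
  ⟨besselRatio_le_torusXYBondEnergy (by omega) hK.le b, torusXYBondEnergy_le hL hK b⟩

/-- **Every admissible energy ceiling is at least the two-spin value**: if `E ≥ E_L(c·K)` for some `c ≥ 1` (the
hypothesis shape of `torusXY_abs_expect_cosDiff_le_rpow_of_bondEnergy_le`, `c = cosh(q log 2)`), then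
`E ≥ u(K)` (`L ≥ 2`, `K ≥ 0`). [cite: Ginibre1970, Prop. 3 with Example 4 (plane rotators)] -/
theorem besselRatio_le_of_admissible (hL : 2 ≤ L) {K c E : ℝ} (hK : 0 ≤ K) (hc : 1 ≤ c) {b : TorusSite 2 L × Fin 2}
    (hE : torusXYBondEnergy L (c * K) b ≤ E) : besselRatio K ≤ E :=
  (besselRatio_le_torusXYBondEnergy hL hK b).trans
    ((torusXYBondEnergy_mono hK (le_mul_of_one_le_left hK hc) b).trans hE)

omit [NeZero L] [MeasurableSpace Circle] [BorelSpace Circle] in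
/-- Arithmetic of the energy-class exponent: for `K > 0` and `E ≥ u > 0`,
`2q − 2π(K·E)q² ≤ 1/(2πK·u)` for every real `q` (maximum of `2q − c q²` is `1/c`, and `c ↦ 1/c` decreases).
[cite: McBryanSpencer1977, main theorem (choice of the exponent)] -/
theorem energyExponent_le_inv {K E u : ℝ} (hK : 0 < K) (hu : 0 < u) (hE : u ≤ E) (q : ℝ) :
    2 * q - 2 * Real.pi * (K * E) * q ^ 2 ≤ 1 / (2 * Real.pi * K * u) := by
  have hc : 0 < 2 * Real.pi * K * u := by positivity
  have h1 : 2 * q - 2 * Real.pi * (K * E) * q ^ 2 ≤ 2 * q - 2 * Real.pi * K * u * q ^ 2 := by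
    have : 2 * Real.pi * K * u * q ^ 2 ≤ 2 * Real.pi * (K * E) * q ^ 2 := by
      have hq2 : 0 ≤ q ^ 2 := sq_nonneg q
      have : 2 * Real.pi * K * u ≤ 2 * Real.pi * (K * E) := by nlinarith [Real.pi_pos]
      exact mul_le_mul_of_nonneg_right this hq2
    linarith
  refine h1.trans ?_
  rw [div_eq_mul_inv, one_mul]
  have hsq : 0 ≤ (2 * Real.pi * K * u) * (q - (2 * Real.pi * K * u)⁻¹) ^ 2 := by positivity
  have hexp : (2 * Real.pi * K * u) * (q - (2 * Real.pi * K * u)⁻¹) ^ 2 =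
      2 * Real.pi * K * u * q ^ 2 - 2 * q + (2 * Real.pi * K * u)⁻¹ := by
    field_simp
    ring
  linarith

/-- **The ceiling of the energy class.** In the energy-renormalised McBryan–Spencer theorem
(`torusXY_abs_expect_cosDiff_le_rpow_of_bondEnergy_le`: exponent `f = 2q − 2πK·E·q²` for any
`E ≥ E_L(cosh(q log 2)·K)`), every admissible `E` is `≥ u(K)`, hence **`f ≤ 1/(2πK·u(K))`** whatever certified
energy ceiling is fed in (`L ≥ 2`, `K > 0`, `q ≥ 0`). [cite: McBryanSpencer1977, main theorem] -/
theorem energyExponent_le_of_admissible (hL : 2 ≤ L) {K q E : ℝ} (hK : 0 < K)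
    (hE : torusXYBondEnergy L (Real.cosh (q * Real.log 2) * K) (0, 0) ≤ E) :
    2 * q - 2 * Real.pi * (K * E) * q ^ 2 ≤ 1 / (2 * Real.pi * K * besselRatio K) :=
  energyExponent_le_inv hK (div_pos (besselI_pos hK 1) (besselI_pos hK 0))
    (besselRatio_le_of_admissible hL hK.le (Real.one_le_cosh _) hE) q

/-! ### §6 Statement design: no volume-uniform decay bound can carry a divergent exponent -/

omit [MeasurableSpace Circle] [BorelSpace Circle] in
/-- The periodic `ℓ^∞` norm of `n·eᵢ` is `n` when `2n ≤ L`. [cite: FriedliVelenik2017, §3.1 (periodic boundary condition)] -/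
theorem torusNorm_single_natCast {n : ℕ} (h2n : 2 * n ≤ L) (i : Fin d) :
    torusNorm (Ls := fun _ : Fin d => L) (Pi.single i ((n : ℕ) : ZMod L) : TorusSite d L) = n := by
  classical
  have hnL : n < L ∨ n = 0 := by
    rcases Nat.eq_zero_or_pos n with h | h
    · exact Or.inr h
    · left; have := NeZero.pos L; omega
  have hval : ((n : ℕ) : ZMod L).val = n := by
    rcases hnL with h | h
    · exact ZMod.val_natCast_of_lt h
    · subst h; simp
  unfold torusNorm
  apply le_antisymm
  · refine Finset.sup_le fun j _ => ?_
    by_cases hj : j = i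
    · subst hj
      rw [Pi.single_eq_same, hval]
      exact min_le_left _ _
    · rw [Pi.single_eq_of_ne hj, ZMod.val_zero]
      exact (min_le_left _ _).trans (Nat.zero_le _)
  · refine le_trans ?_ (Finset.le_sup (f := fun j => min ((Pi.single i ((n : ℕ) : ZMod L) : TorusSite d L) j).val
      (L - ((Pi.single i ((n : ℕ) : ZMod L) : TorusSite d L) j).val)) (Finset.mem_univ i))
    simp only [Pi.single_eq_same, hval]
    exact le_min le_rfl (by omega)

omit [MeasurableSpace Circle] [BorelSpace Circle] in
/-- The torus distance from `x` to `x + n·eᵢ` is `n` when `2n ≤ L`. [cite: FriedliVelenik2017, §3.1 (periodic boundary condition)] -/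
theorem torusDist_add_single_natCast {n : ℕ} (h2n : 2 * n ≤ L) (x : TorusSite d L) (i : Fin d) :
    torusDist x (x + Pi.single i ((n : ℕ) : ZMod L)) = n := by
  rw [torusDist_comm', torusDist, add_sub_cancel_left]
  exact torusNorm_single_natCast h2n i

/-- **No volume-uniform decay bound with a divergent exponent.** Let `d ≥ 1`, `K > 0`, `B > 0`, `A` real, and let
`f : ℕ → ℝ` tend to `+∞`. Then it is FALSE that for every `L ≥ 3` and all sites `x, y` of `(ℤ/Lℤ)^d`
`|⟨cos(θ_x − θ_y)⟩_{K,L}| ≤ A · B^{f(L)} · (dist(x,y) + 1)^{−f(L)}` — the shape of the tree's McBryan–Spencer /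
energy-renormalised theorems, which hold with `f` INDEPENDENT of `L`. Witness: `y = x + n·e₀` with `n + 1 > B`;
the path floor gives `u(K)^n > 0` for all `L > 2n`, while `A·(B/(n+1))^{f(L)} → 0`.
READING (crux №2, statement design): «exponent `1/(2πK·y_L(K))` with constants uniform in `L`» is refutable at
every `K` where the finite-volume renormalised coupling `y_L(K) → 0`; a stiffness-class conjecture on a finite-volume
helicity modulus therefore needs a window hypothesis or the `L → ∞` stiffness. [cite: McBryanSpencer1977, main theorem (form of the bound)] -/
theorem torusXY_not_uniform_decay_of_tendsto (hd : 1 ≤ d) {K : ℝ} (hK : 0 < K) {f : ℕ → ℝ}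
    (hf : Tendsto f atTop atTop) (A : ℝ) {B : ℝ} (hB : 0 < B) :
    ¬ ∀ (L : ℕ) [NeZero L], 3 ≤ L → ∀ x y : TorusSite d L,
        |(torusXY d L).expect K 1 (cosDiff x y)| ≤ A * (B ^ (f L) * ((torusDist x y : ℝ) + 1) ^ (-(f L))) := by
  intro h
  -- the witness distance `n` with `B < n + 1`, `n ≥ 1`
  obtain ⟨n, hn1, hnB⟩ : ∃ n : ℕ, 1 ≤ n ∧ B < n + 1 := by
    refine ⟨max 1 ⌈B⌉₊, le_max_left _ _, ?_⟩
    have : B ≤ ⌈B⌉₊ := Nat.le_ceil B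
    have : (⌈B⌉₊ : ℝ) ≤ ((max 1 ⌈B⌉₊ : ℕ) : ℝ) := by exact_mod_cast le_max_right 1 ⌈B⌉₊
    linarith
  set r : ℝ := B / (n + 1) with hr
  have hr0 : 0 < r := by positivity
  have hr1 : r < 1 := (div_lt_one (by positivity)).2 hnB
  have hu : 0 < besselRatio K ^ n := pow_pos (div_pos (besselI_pos hK 1) (besselI_pos hK 0)) n
  -- `A * r^{f L} → 0`, so eventually `A * r^{f L} < u(K)^n`; also eventually `L ≥ 2n + 3`
  have hlim : Tendsto (fun L => A * r ^ (f L)) atTop (𝓝 0) := by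
    have h1 : Tendsto (fun L => r ^ (f L)) atTop (𝓝 0) :=
      (tendsto_rpow_atTop_of_base_lt_one r (by linarith) hr1).comp hf
    simpa using h1.const_mul A
  have hev : ∀ᶠ L in atTop, A * r ^ (f L) < besselRatio K ^ n := (tendsto_order.1 hlim).2 _ hu
  obtain ⟨L, hL⟩ := (hev.and (eventually_ge_atTop (2 * n + 3))).exists
  obtain ⟨hlt, hLge⟩ := hL
  haveI : NeZero L := ⟨by omega⟩
  set i : Fin d := ⟨0, hd⟩
  set x : TorusSite d L := 0
  set y : TorusSite d L := x + Pi.single i ((n : ℕ) : ZMod L)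
  have hfloor : besselRatio K ^ n ≤ (torusXY d L).expect K 1 (cosDiff x y) :=
    torusXY_pow_besselRatio_le_expect_cosDiff (by omega) hK.le x i
  have hdist : (torusDist x y : ℝ) + 1 = n + 1 := by
    rw [show torusDist x y = n from torusDist_add_single_natCast (by omega) x i]
  have hbound := h L (by omega) x y
  rw [hdist, Real.rpow_neg (by positivity), ← div_eq_mul_inv, ← Real.div_rpow hB.le (by positivity)] at hbound
  have : (torusXY d L).expect K 1 (cosDiff x y) ≤ |(torusXY d L).expect K 1 (cosDiff x y)| := le_abs_self _
  linarith

/-- The same with `B = 1`: no bound `|⟨cos(θ_x − θ_y)⟩_{K,L}| ≤ A · (dist + 1)^{−f(L)}` uniform in `L` with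
`f(L) → ∞`. [cite: McBryanSpencer1977, main theorem (form of the bound)] -/
theorem torusXY_not_uniform_decay_of_tendsto' (hd : 1 ≤ d) {K : ℝ} (hK : 0 < K) {f : ℕ → ℝ}
    (hf : Tendsto f atTop atTop) (A : ℝ) :
    ¬ ∀ (L : ℕ) [NeZero L], 3 ≤ L → ∀ x y : TorusSite d L,
        |(torusXY d L).expect K 1 (cosDiff x y)| ≤ A * ((torusDist x y : ℝ) + 1) ^ (-(f L)) := by
  intro h
  refine torusXY_not_uniform_decay_of_tendsto hd hK hf A one_pos fun L _ hL x y => ?_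
  rw [Real.one_rpow, one_mul]
  exact h L hL x y

end Torus

end Literature.Probability.LatticeModels

end
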